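import Summits.CriticalPhenomena.CardyFormulaZ2.Theorems.CardyComplexConeEdgePrecompactUFRSEvents
import Literature.Probability.Percolation.BondPercolationSymmetry

/-!
# The junction gate: a blocking arch of one open and one dual path meeting at a corner
(line `qkz-strip-boundary-arm` of crux `CardyComplexCone.EdgePrecompact`, stmt-CriticalPhenomena-11387;
vocabulary of the per-scale junction bound HJ-S = registered sub-goal `ufrs_junction_scale_le`,
lead c5, wave 3; definitions only, and their unfolding lemmas)

The per-scale bound HJ-S says that at a Dobrushin junction `m` (a marked `A`–`B` edge of the
datum `E` or of its translate `shiftData E w`) two corner-DISJOINT strand-crossings of the annulus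
`A(m; r, K r)` (the event `ufrsStrands E w m 2 r (K r)` of `…UFRSEvents.lean`) fail with
probability at least `c > 0`, uniformly in the scale. The mechanism is a GATE of the configuration
`ω` (this file) and a FUNNEL (the deterministic statement `ufrs_junctionFunnel`, registered):

* **Gate** (`ufrsGateWith`). In pure bond-percolation terms: an `ω`-OPEN simple lattice path `P`
  from a site `v₀` to a foot set `FA` inside a region `RA`, an `ω`-CLOSED simple dual path `Q`
  (a walk of faces = lower-left corners, consecutive faces separated by `ω`-closed primal edges
  `sepEdge`) from a face `f₀` to a foot set `FB` inside a region `RB`, such that `v₀` is a corner of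
  `f₀` (`IsCorner v₀ f₀`) and no edge crossed by `Q` touches a vertex of `P`. The arch
  `P ∪ [v₀, centre of f₀] ∪ Q` is the fence of the funnel: an exploration interface of the
  completed configuration never crosses a completion-open edge (the edges of `P`, in the bulk or
  landing on the wired arc) nor the dual edge of a completion-closed edge (the edges crossed by
  `Q`, in the bulk or landing on the free arc), so it crosses the arch only through the link
  `[v₀, centre of f₀]`, i.e. through the single dart of `f₀` around `v₀`; two corner-disjoint
  crossing strands cannot both do so.
* **Reference regions** (`ufrsGateRA`, `ufrsGateFA`, `ufrsGateRB`, `ufrsGateFB`, scale `N`, depth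
  `h`, in lattice units around the origin). FLAT junction (`corner = false`; wired arc to the east
  on the boundary rows `-h ≤ x₁ ≤ h` of `E` and of its translate, domain above): `P` lives in the
  pillar `[2N, 4N] × [-h, 4N]` and the bar `[-4N, 4N] × [2N, 4N]` and lands on the row `x₁ = -h`;
  `Q` lives in the faces `[-4N, -2N-1] × [-h-1, 4N]` and lands on the face row `x₁ = -h-1`.
  CORNER junction (`corner = true`; corner of the lattice box within `h` of the origin, wired arc up
  the left column, free arc along the bottom row, domain the north-east quadrant): `P` lives in
  the bar `[-h, 4N] × [2N, 4N]` and lands on the column `x₀ = -h`; `Q` lives in the faces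
  `[2N, 4N-1] × [-h-1, 4N]` and lands on the face row `x₁ = -h-1`. In both cases the arch stays
  outside the open sup-norm ball of radius `2N` and inside the one of radius `4N + h + 1`.
* **Orientations** (`ufrsJunctionGate φ corner N h`). The other sides, corners and chiralities
  (which of the two arcs is wired) are the images of the reference gate under a graph automorphism
  `φ` of `ℤ²` (a lattice symmetry composed with a translation): `ω ∈ ufrsJunctionGate φ corner N h`
  iff the relabelled configuration `φ '' ω` (`BondConfig.relabel`) lies in the reference gate, so
  that the physical arch is the `φ`-PREIMAGE of a reference arch. By the isomorphism invariance of
  `P_{1/2}` (`bondPercolation_real_preimage_relabel_iso`) its probability does not depend on `φ`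
  (`real_ufrsJunctionGate`), and the lower bound `ufrs_junctionGate_prob` (registered; RSW, Harris,
  and a Basu–Sapozhnikov exploration to produce the corner `(v₀, f₀)`) is proved once.

References: H. Kesten, Comm. Math. Phys. 109 (1987), §2 (blocking circuits and fences);
D. Basu, A. Sapozhnikov, Electron. Commun. Probab. 22 (2017), §2 (exploration from inside);
S. Smirnov, C. R. Acad. Sci. Paris 333 (2001), §2 (the exploration interface follows open edges on
its left and dual-open edges on its right); G. Grimmett, *Percolation* (1999), §11.2, §11.7.
-/

namespace Summit.CriticalPhenomena.CardyFormulaZ2.Cruxes.EdgePrecompact.QkzStripBoundaryArm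

open MeasureTheory Filter Set Metric
open scoped Topology BigOperators Pointwise
open Literature.Probability.LatticeModels Literature.Probability.Percolation
open Literature.Probability.RandomPlanarGeometry (DobrushinDomain)
open Summit.CriticalPhenomena.CardyFormulaZ2.Theses.CardyComplexCone

noncomputable section

/-! ## The structural gate -/

/-- **The gate with regions `RA`, `FA` (open path and its foot) and `RB`, `FB` (dual path and its
foot)**: configurations `ω` carrying an `ω`-open simple lattice path `P` from a site `v₀` to a site
of `FA`, all of whose vertices lie in `RA`, and a simple walk of faces `Q` from a face `f₀` having
`v₀` as a corner to a face of `FB`, all of whose faces lie in `RB`, each step of which crosses an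
`ω`-closed primal edge (`sepEdge`) touching no vertex of `P`. -/
def ufrsGateWith (RA FA RB FB : Set (Site 2)) : Set (BondConfig (Site 2)) :=
  {ω | ∃ (v₀ u f₀ g : Site 2) (P : (zdGraph 2).Walk v₀ u) (Q : (zdGraph 2).Walk f₀ g),
    Literature.Probability.LatticeModels.IsCorner v₀ f₀ ∧ P.IsPath ∧ Q.IsPath ∧ (∀ z ∈ P.support, z ∈ RA) ∧ u ∈ FA ∧
    (∀ e ∈ P.edges, e ∈ ω) ∧ (∀ z ∈ Q.support, z ∈ RB) ∧ g ∈ FB ∧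
    (∀ d ∈ Q.darts, sepEdge d.fst d.snd ∉ ω) ∧
    (∀ d ∈ Q.darts, ∀ x ∈ sepEdge d.fst d.snd, x ∉ P.support)}

/-- Membership in `ufrsGateWith`, unfolded. -/
theorem mem_ufrsGateWith_iff (RA FA RB FB : Set (Site 2)) (ω : BondConfig (Site 2)) :
    ω ∈ ufrsGateWith RA FA RB FB ↔ ∃ (v₀ u f₀ g : Site 2) (P : (zdGraph 2).Walk v₀ u) (Q : (zdGraph 2).Walk f₀ g),
      Literature.Probability.LatticeModels.IsCorner v₀ f₀ ∧ P.IsPath ∧ Q.IsPath ∧ (∀ z ∈ P.support, z ∈ RA) ∧ u ∈ FA ∧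
      (∀ e ∈ P.edges, e ∈ ω) ∧ (∀ z ∈ Q.support, z ∈ RB) ∧ g ∈ FB ∧
      (∀ d ∈ Q.darts, sepEdge d.fst d.snd ∉ ω) ∧
      (∀ d ∈ Q.darts, ∀ x ∈ sepEdge d.fst d.snd, x ∉ P.support) :=
  Iff.rfl

/-- The gate is monotone in its four regions. -/
theorem ufrsGateWith_mono {RA FA RB FB RA' FA' RB' FB' : Set (Site 2)} (hRA : RA ⊆ RA') (hFA : FA ⊆ FA')
    (hRB : RB ⊆ RB') (hFB : FB ⊆ FB') : ufrsGateWith RA FA RB FB ⊆ ufrsGateWith RA' FA' RB' FB' := by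
  rintro ω ⟨v₀, u, f₀, g, P, Q, h1, h2, h3, h4, h5, h6, h7, h8, h9, h10⟩
  exact ⟨v₀, u, f₀, g, P, Q, h1, h2, h3, fun z hz => hRA (h4 z hz), hFA h5, h6,
    fun z hz => hRB (h7 z hz), hFB h8, h9, h10⟩

/-! ## The reference regions (scale `N`, depth `h`, lattice units, centred at the origin) -/

/-- Region of the open path: FLAT (`false`) — the pillar `[2N, 4N] × [-h, 4N]` and the bar
`[-4N, 4N] × [2N, 4N]`; CORNER (`true`) — the bar `[-h, 4N] × [2N, 4N]`. -/
def ufrsGateRA : Bool → ℕ → ℕ → Set (Site 2)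
  | false, N, h => {z | ((2 * N : ℤ) ≤ z 0 ∧ z 0 ≤ 4 * N ∧ -(h : ℤ) ≤ z 1 ∧ z 1 ≤ 4 * N) ∨
      (-(4 * N : ℤ) ≤ z 0 ∧ z 0 ≤ 4 * N ∧ (2 * N : ℤ) ≤ z 1 ∧ z 1 ≤ 4 * N)}
  | true, N, h => {z | -(h : ℤ) ≤ z 0 ∧ z 0 ≤ 4 * N ∧ (2 * N : ℤ) ≤ z 1 ∧ z 1 ≤ 4 * N}

/-- Foot of the open path: FLAT — the bottom row `[2N, 4N] × {-h}` of the pillar (below the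
boundary rows of the datum and of its translate, on the side of the wired arc); CORNER — the left
column `{-h} × [2N, 4N]` of the bar (left of the wired column). -/
def ufrsGateFA : Bool → ℕ → ℕ → Set (Site 2)
  | false, N, h => {z | (2 * N : ℤ) ≤ z 0 ∧ z 0 ≤ 4 * N ∧ z 1 = -(h : ℤ)}
  | true, N, h => {z | z 0 = -(h : ℤ) ∧ (2 * N : ℤ) ≤ z 1 ∧ z 1 ≤ 4 * N}

/-- Region of the dual path (faces, indexed by lower-left corners): FLAT — the faces
`[-4N, -2N-1] × [-h-1, 4N]` (covering the strip `-4N ≤ x ≤ -2N`); CORNER — the faces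
`[2N, 4N-1] × [-h-1, 4N]` (covering the strip `2N ≤ x ≤ 4N`). -/
def ufrsGateRB : Bool → ℕ → ℕ → Set (Site 2)
  | false, N, h => {z | -(4 * N : ℤ) ≤ z 0 ∧ z 0 + 1 ≤ -(2 * N : ℤ) ∧ -(h : ℤ) - 1 ≤ z 1 ∧ z 1 ≤ 4 * N}
  | true, N, h => {z | (2 * N : ℤ) ≤ z 0 ∧ z 0 + 1 ≤ 4 * N ∧ -(h : ℤ) - 1 ≤ z 1 ∧ z 1 ≤ 4 * N}

/-- Foot of the dual path: the bottom face row `x₁ = -h-1` of `ufrsGateRB` (below the boundary rows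
of the datum and of its translate, on the side of the free arc). -/
def ufrsGateFB : Bool → ℕ → ℕ → Set (Site 2)
  | false, N, h => {z | -(4 * N : ℤ) ≤ z 0 ∧ z 0 + 1 ≤ -(2 * N : ℤ) ∧ z 1 = -(h : ℤ) - 1}
  | true, N, h => {z | (2 * N : ℤ) ≤ z 0 ∧ z 0 + 1 ≤ 4 * N ∧ z 1 = -(h : ℤ) - 1}

/-- `ufrsGateRA false`, unfolded. -/
theorem mem_ufrsGateRA_false {N h : ℕ} {z : Site 2} : z ∈ ufrsGateRA false N h ↔
    ((2 * N : ℤ) ≤ z 0 ∧ z 0 ≤ 4 * N ∧ -(h : ℤ) ≤ z 1 ∧ z 1 ≤ 4 * N) ∨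
      (-(4 * N : ℤ) ≤ z 0 ∧ z 0 ≤ 4 * N ∧ (2 * N : ℤ) ≤ z 1 ∧ z 1 ≤ 4 * N) := Iff.rfl

/-- `ufrsGateRA true`, unfolded. -/
theorem mem_ufrsGateRA_true {N h : ℕ} {z : Site 2} : z ∈ ufrsGateRA true N h ↔
    -(h : ℤ) ≤ z 0 ∧ z 0 ≤ 4 * N ∧ (2 * N : ℤ) ≤ z 1 ∧ z 1 ≤ 4 * N := Iff.rfl

/-- `ufrsGateFA false`, unfolded. -/
theorem mem_ufrsGateFA_false {N h : ℕ} {z : Site 2} : z ∈ ufrsGateFA false N h ↔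
    (2 * N : ℤ) ≤ z 0 ∧ z 0 ≤ 4 * N ∧ z 1 = -(h : ℤ) := Iff.rfl

/-- `ufrsGateFA true`, unfolded. -/
theorem mem_ufrsGateFA_true {N h : ℕ} {z : Site 2} : z ∈ ufrsGateFA true N h ↔
    z 0 = -(h : ℤ) ∧ (2 * N : ℤ) ≤ z 1 ∧ z 1 ≤ 4 * N := Iff.rfl

/-- `ufrsGateRB false`, unfolded. -/
theorem mem_ufrsGateRB_false {N h : ℕ} {z : Site 2} : z ∈ ufrsGateRB false N h ↔
    -(4 * N : ℤ) ≤ z 0 ∧ z 0 + 1 ≤ -(2 * N : ℤ) ∧ -(h : ℤ) - 1 ≤ z 1 ∧ z 1 ≤ 4 * N := Iff.rfl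

/-- `ufrsGateRB true`, unfolded. -/
theorem mem_ufrsGateRB_true {N h : ℕ} {z : Site 2} : z ∈ ufrsGateRB true N h ↔
    (2 * N : ℤ) ≤ z 0 ∧ z 0 + 1 ≤ 4 * N ∧ -(h : ℤ) - 1 ≤ z 1 ∧ z 1 ≤ 4 * N := Iff.rfl

/-- `ufrsGateFB false`, unfolded. -/
theorem mem_ufrsGateFB_false {N h : ℕ} {z : Site 2} : z ∈ ufrsGateFB false N h ↔
    -(4 * N : ℤ) ≤ z 0 ∧ z 0 + 1 ≤ -(2 * N : ℤ) ∧ z 1 = -(h : ℤ) - 1 := Iff.rfl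

/-- `ufrsGateFB true`, unfolded. -/
theorem mem_ufrsGateFB_true {N h : ℕ} {z : Site 2} : z ∈ ufrsGateFB true N h ↔
    (2 * N : ℤ) ≤ z 0 ∧ z 0 + 1 ≤ 4 * N ∧ z 1 = -(h : ℤ) - 1 := Iff.rfl

/-- The foot of the open path lies in its region. -/
theorem ufrsGateFA_subset_ufrsGateRA (corner : Bool) (N h : ℕ) : ufrsGateFA corner N h ⊆ ufrsGateRA corner N h := by
  cases corner
  · rintro z ⟨h1, h2, h3⟩
    exact Or.inl ⟨h1, h2, by omega, by omega⟩
  · rintro z ⟨h1, h2, h3⟩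
    exact ⟨by omega, by omega, h2, h3⟩

/-- The foot of the dual path lies in its region. -/
theorem ufrsGateFB_subset_ufrsGateRB (corner : Bool) (N h : ℕ) : ufrsGateFB corner N h ⊆ ufrsGateRB corner N h := by
  cases corner
  · rintro z ⟨h1, h2, h3⟩
    exact ⟨h1, h2, by omega, by omega⟩
  · rintro z ⟨h1, h2, h3⟩
    exact ⟨h1, h2, by omega, by omega⟩

/-- **The arch avoids the inner ball**: a vertex of the region of the open path has sup-norm
`≥ 2N`. -/
theorem two_mul_le_of_mem_ufrsGateRA {corner : Bool} {N h : ℕ} {z : Site 2} (hz : z ∈ ufrsGateRA corner N h) :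
    (2 * N : ℤ) ≤ z 0 ∨ (2 * N : ℤ) ≤ z 1 := by
  cases corner
  · rcases hz with ⟨h1, -, -, -⟩ | ⟨-, -, h3, -⟩
    · exact Or.inl h1
    · exact Or.inr h3
  · exact Or.inr hz.2.2.1

/-- **The arch avoids the inner ball**: a face of the region of the dual path spans abscissae
`≤ -2N` (flat) or `≥ 2N` (corner). -/
theorem two_mul_le_of_mem_ufrsGateRB {corner : Bool} {N h : ℕ} {z : Site 2} (hz : z ∈ ufrsGateRB corner N h) :
    z 0 + 1 ≤ -(2 * N : ℤ) ∨ (2 * N : ℤ) ≤ z 0 := by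
  cases corner
  · exact Or.inl hz.2.1
  · exact Or.inr hz.1

/-- **The arch stays in the outer ball**: vertices of `ufrsGateRA` have coordinates in
`[-(4N + h), 4N]`. -/
theorem abs_le_of_mem_ufrsGateRA {corner : Bool} {N h : ℕ} {z : Site 2} (hz : z ∈ ufrsGateRA corner N h) :
    (-(4 * N : ℤ) - h ≤ z 0 ∧ z 0 ≤ 4 * N) ∧ (-(4 * N : ℤ) - h ≤ z 1 ∧ z 1 ≤ 4 * N) := by
  cases corner <;> simp only [ufrsGateRA, Set.mem_setOf_eq] at hz <;> omega

/-- **The arch stays in the outer ball**: faces of `ufrsGateRB` have coordinates in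
`[-(4N + h + 1), 4N]`. -/
theorem abs_le_of_mem_ufrsGateRB {corner : Bool} {N h : ℕ} {z : Site 2} (hz : z ∈ ufrsGateRB corner N h) :
    (-(4 * N : ℤ) - h - 1 ≤ z 0 ∧ z 0 ≤ 4 * N) ∧ (-(4 * N : ℤ) - h - 1 ≤ z 1 ∧ z 1 ≤ 4 * N) := by
  cases corner <;> simp only [ufrsGateRB, Set.mem_setOf_eq] at hz <;> omega

/-! ## The reference gate and its images under the symmetries of `ℤ²` -/

/-- **The reference junction gate** at scale `N` and depth `h` (flat: `corner = false`; at a corner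
of the box: `corner = true`), centred at the origin in the reference orientation. -/
def ufrsGateRef (corner : Bool) (N h : ℕ) : Set (BondConfig (Site 2)) :=
  ufrsGateWith (ufrsGateRA corner N h) (ufrsGateFA corner N h) (ufrsGateRB corner N h) (ufrsGateFB corner N h)

/-- `ufrsGateRef`, unfolded. -/
theorem ufrsGateRef_eq (corner : Bool) (N h : ℕ) : ufrsGateRef corner N h =
    ufrsGateWith (ufrsGateRA corner N h) (ufrsGateFA corner N h) (ufrsGateRB corner N h) (ufrsGateFB corner N h) := rfl

/-- **The junction gate in the orientation `φ`**: the preimage of the reference gate under the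
relabelling `ω ↦ φ '' ω` of configurations by the graph automorphism `φ` of `ℤ²` (so the physical
open path, dual path and corner are the `φ`-preimages of reference ones). -/
def ufrsJunctionGate (φ : zdGraph 2 ≃g zdGraph 2) (corner : Bool) (N h : ℕ) : Set (BondConfig (Site 2)) :=
  BondConfig.relabel (sym2Equiv φ.toEquiv) ⁻¹' ufrsGateRef corner N h

/-- Membership in `ufrsJunctionGate`, unfolded. -/
theorem mem_ufrsJunctionGate_iff (φ : zdGraph 2 ≃g zdGraph 2) (corner : Bool) (N h : ℕ) (ω : BondConfig (Site 2)) :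
    ω ∈ ufrsJunctionGate φ corner N h ↔ BondConfig.relabel (sym2Equiv φ.toEquiv) ω ∈ ufrsGateRef corner N h :=
  Iff.rfl

/-- In the identity orientation the gate is the reference gate. -/
theorem ufrsJunctionGate_refl (corner : Bool) (N h : ℕ) :
    ufrsJunctionGate (RelIso.refl _) corner N h = ufrsGateRef corner N h := by
  ext ω
  rw [mem_ufrsJunctionGate_iff]
  have hω : BondConfig.relabel (sym2Equiv (RelIso.refl ((zdGraph 2).Adj)).toEquiv) ω = ω := by
    ext e
    rw [BondConfig.mem_relabel_iff]
    induction e using Sym2.ind with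
    | h x y => rfl
  rw [hω]

/-- **The probability of the gate does not depend on the orientation** (isomorphism invariance of
bond percolation, `bondPercolation_real_preimage_relabel_iso`; registered anchor of this file). -/
theorem real_ufrsJunctionGate : ∀ (p : unitInterval) (φ : zdGraph 2 ≃g zdGraph 2) (corner : Bool) (N h : ℕ), (bondPercolation (zdGraph 2) p).real (ufrsJunctionGate φ corner N h) = (bondPercolation (zdGraph 2) p).real (ufrsGateRef corner N h) :=
  fun p φ _ _ _ => bondPercolation_real_preimage_relabel_iso φ p _

/-- An open edge of the relabelled configuration is the image of an open edge:
`s(φ x, φ y) ∈ φ '' ω ↔ s(x, y) ∈ ω` (`mk_mem_relabel_iff`, restated for graph automorphisms). -/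
theorem mk_mem_relabel_iso_iff (φ : zdGraph 2 ≃g zdGraph 2) (ω : BondConfig (Site 2)) (x y : Site 2) :
    s(φ x, φ y) ∈ BondConfig.relabel (sym2Equiv φ.toEquiv) ω ↔ s(x, y) ∈ ω :=
  mk_mem_relabel_iff φ.toEquiv ω x y

end

end Summit.CriticalPhenomena.CardyFormulaZ2.Cruxes.EdgePrecompact.QkzStripBoundaryArm
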